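import Summits.BirchSwinnertonDyer.BirchSwinnertonDyer.Theorems.GoldfeldAllTwistsTwoConverseTwinGenusDescentNegTwo
import Summits.BirchSwinnertonDyer.BirchSwinnertonDyer.Theorems.GoldfeldAllTwistsTwoConverseTwinAdditiveRootNumber
import Literature.NumberTheory.EllipticCurves.QuadraticTwistTateFormTwoProofs
import Literature.NumberTheory.EllipticCurves.Rank1Residual.X11RankOneCertificates.Minimality
import Literature.NumberTheory.EllipticCurves.SzpiroOfAbcProofs
import Literature.NumberTheory.EllipticCurves.BSDRootNumber
import HarnessLib

set_option linter.dupNamespace false -- `…BirchSwinnertonDyer.BirchSwinnertonDyer…` is the cell's namespace (D-0017)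
set_option autoImplicit false

/-!
# LINE B49 — the FIXED partner curves, III: globally minimal models, conductors, the bsd.S31 hook

Cell `bsd-goldfeld`, seat `bsd-goldfeld-s1p-c301` (prover, gen 6); TARGET v5.2 §2 c301 (f), planner g14
(xvi); support for item `stmt-BirchSwinnertonDyer-19140` (twin″; joint with 20044). HONEST FRAMING: no BSD
statement is proved here — §4 takes bsd.S31 (`bsdTriple_of_rank_le_one_of_conductor_lt`, Creutz–Miller
2012 / Miller 2011, computer-assisted in print) and Modularity (`exists_isNewformOf`) as NAMED binders.
§1 a reusable KRAUS-AT-`2` minimality test for integer models (`2⁸ ∤ c₄`, `c₆ = 64d`, `4 ∤ d+1` ⇒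
minimal at `2`; tree `isMinimal_of_kraus_fails`, Kraus 1989 Prop. 2) — needed because all three
two-torsion models `[0,−21,0,112,0]` (`49a1^{(−1)}`, `ord₂Δ = 12`, `ord₂c₄ = 4`), `[0,∓42,0,448,0]`
(`49a1^{(∓2)}`, `ord₂Δ = 18`, `ord₂c₄ = 6`) FAIL Silverman's `ord`-criterion at `2`; §2
`isGloballyMinimal_baseChange_int_of_kraus` (+ Silverman VII.1.1 at odd `p`) and the three instances
(kernel, `decide` on the integer invariants); §3 `N = 784, 3136, 3136` from the tree's Atkin–Lehner
twist lemmas and `conductorNorm_cm7 = 49` (modulo Modularity); §4 `BSDTriple` of the `784`- and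
`3136⁻`-models BY NAME from `rank = 1` (files I–II), hence `r_an = 1`, `Ш` finite of ODD order
(`Ш[2] = 0` in the kernel + Cauchy), and the leading-term formula — the fixed-curve inputs of Theorem A
of the genus mechanism (memo `B49-GENUS.md` §§3–4). References: [Kraus1989] Prop. 2; [SilvermanAEC2009]
VII.1.1, VIII.8; [AtkinLehner1970] §6; [CremonaAlgorithms1997] Table 1; [CreutzMiller2012]; [Miller2011LMS].
-/

noncomputable section

open scoped Classical

open WeierstrassCurve IsDedekindDomain NumberField Rat.HeightOneSpectrum
  Literature.NumberTheory.EllipticCurves Literature.NumberTheory.EllipticCurves.ModularForms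
  Literature.NumberTheory.EllipticCurves.Rank1Residual.X11RankOneCertificates
  Literature.NumberTheory.GaloisRepresentations

namespace Summit.BirchSwinnertonDyer.BirchSwinnertonDyer.Theorems.GoldfeldGoodTwists

/-! ## §1 A Kraus-at-`2` minimality test for integer models -/

section Kraus

variable (v : HeightOneSpectrum (𝓞 ℚ))

/-- **Kraus-at-`2` minimality test in integer form.** Let `M` be an integer Weierstrass model with
`2⁸ ∤ c₄(M)` and `c₆(M) = 64 d` with `4 ∤ d + 1`. Then `M ⊗ ℚ` is minimal at the place above `2`:
the only possible descent is `u = 2w` (`w` a `2`-adic unit), for which `c₄' = c₄/(16w⁴)` has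
`|c₄'|₂ > 2⁻⁴` (so the branch `2⁴ ∣ c₄'` of Kraus's condition fails) and `c₆' + 1 = (d + w⁶)/w⁶`
has `|c₆' + 1|₂ = |d + 1|₂ > 2⁻²` because `w⁶ ≡ 1 (mod 8)` (so the branch `4 ∣ c₆' + 1` fails);
tree `isMinimal_of_kraus_fails`. [cite: Kraus1989, Prop. 2] [cite: SilvermanAEC2009, VII.1 Remark 1.1] -/
theorem isMinimalAt_two_of_kraus_fails_int (hv : natGenerator v = 2) (M : WeierstrassCurve ℤ) {d : ℤ}
    (h8 : ¬ (2 : ℤ) ^ 8 ∣ M.c₄) (h6 : M.c₆ = 64 * d) (hd : ¬ (2 : ℤ) ^ 2 ∣ d + 1) :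
    (M.baseChange ℚ).IsMinimalAt v := by
  set K := v.adicCompletion ℚ with hK
  have hint : (M.baseChange ℚ).IsIntegralAt v := by
    have hle : ∀ m : ℤ, v.valuation ℚ (m : ℚ) ≤ 1 := fun m ↦ by
      have hm : (m : ℚ) = algebraMap (𝓞 ℚ) ℚ (m : 𝓞 ℚ) := by simp
      rw [hm]; exact v.valuation_le_one _
    refine (M.baseChange ℚ).isIntegralAt_of_valuation_le_one v ?_ ?_ ?_ ?_ ?_ <;>
      simp only [baseChange, map_a₁, map_a₂, map_a₃, map_a₄, map_a₆, algebraMap_int_eq,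
        Int.coe_castRingHom] <;> exact hle _
  haveI : ((M.baseChange ℚ).baseChange K).IsIntegral (v.adicCompletionIntegers ℚ) := hint
  have V2 := valued_two v hv
  have hc₄ : ((M.baseChange ℚ).baseChange K).c₄ = algebraMap ℚ K (M.c₄ : ℚ) := by
    rw [baseChange, map_c₄, baseChange_int_c₄]
  have hc₆ : ((M.baseChange ℚ).baseChange K).c₆ = algebraMap ℚ K (M.c₆ : ℚ) := by
    rw [baseChange, map_c₆, baseChange_int_c₆]
  -- `|c₄|_v > 2⁻⁸`
  have hv4 : WithZero.exp (-(8 : ℕ) : ℤ) < Valued.v ((M.baseChange ℚ).baseChange K).c₄ := by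
    rw [hc₄, WeierstrassCurve.valued_algebraMap_adicCompletion]
    exact exp_neg_lt_valuation_intCast_of_not_pow_dvd v (by rw [hv]; exact_mod_cast h8)
  refine isMinimal_of_kraus_fails v hv _ (by exact_mod_cast hv4) fun w hw ↦ ?_
  have hw0 : w ≠ 0 := fun h ↦ by rw [h, Valuation.map_zero] at hw; exact zero_ne_one hw
  rintro (⟨hA, -⟩ | hC)
  · -- `|c₄ / (16 w⁴)| = |c₄| · 2⁴ > 2⁻⁴`
    have h16 : Valued.v (16 * w ^ 4 : K) = WithZero.exp (-4 : ℤ) := by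
      rw [Valuation.map_mul, Valuation.map_pow, hw, one_pow, mul_one,
        show (16 : K) = 2 ^ 4 by norm_num, Valuation.map_pow, V2, ← WithZero.exp_nsmul]
      norm_num
    rw [map_div₀, h16, div_le_iff₀ WithZero.exp_pos, ← WithZero.exp_add] at hA
    norm_num at hA
    exact absurd (lt_of_lt_of_le (by exact_mod_cast hv4) hA) (lt_irrefl _)
  · -- `c₆/(64 w⁶) + 1 = (d + w⁶)/w⁶` and `|d + w⁶| = |d + 1| > 2⁻²`
    have hw6 : Valued.v (w ^ 6) = 1 := by rw [Valuation.map_pow, hw, one_pow]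
    have h20 : (2 : K) ≠ 0 := fun h ↦ by
      rw [h, Valuation.map_zero] at V2; exact WithZero.coe_ne_zero V2.symm
    have h64 : (64 : K) ≠ 0 := by rw [show (64 : K) = 2 ^ 6 by norm_num]; exact pow_ne_zero _ h20
    have e : ((M.baseChange ℚ).baseChange K).c₆ / (64 * w ^ 6) + 1 =
        (algebraMap ℚ K (d : ℚ) + w ^ 6) / w ^ 6 := by
      rw [hc₆, h6, show (((64 * d : ℤ)) : ℚ) = 64 * (d : ℚ) by push_cast; ring, map_mul, map_ofNat,
        mul_div_mul_left _ _ h64, div_add_one (pow_ne_zero 6 hw0)]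
    rw [e, map_div₀, hw6, div_one] at hC
    have hsub := valued_pow_six_sub_one_le v hv hw
    -- `d + 1 = (d + w⁶) - (w⁶ - 1)`
    have hle : Valued.v (algebraMap ℚ K ((d + 1 : ℤ) : ℚ)) ≤ WithZero.exp (-2 : ℤ) := by
      have e2 : algebraMap ℚ K ((d + 1 : ℤ) : ℚ) =
          (algebraMap ℚ K (d : ℚ) + w ^ 6) - (w ^ 6 - 1) := by push_cast; ring
      rw [e2]
      refine le_trans (Valuation.map_sub _ _ _) (max_le hC (le_trans hsub ?_))
      exact WithZero.exp_le_exp.mpr (by norm_num)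
    rw [WeierstrassCurve.valued_algebraMap_adicCompletion] at hle
    have hlt := exp_neg_lt_valuation_intCast_of_not_pow_dvd v (n := d + 1) (e := 2)
      (by rw [hv]; exact_mod_cast hd)
    exact absurd (lt_of_lt_of_le hlt hle) (lt_irrefl _)

end Kraus

/-! ## §2 Global minimality: Kraus at `2`, Silverman's `ord_p Δ < 12` at odd `p` -/

section Global

/-- **An integer model passing the Kraus-at-`2` test and with `p¹² ∤ Δ` for every odd prime `p` is a
global minimal model over `ℚ`** (minimal at `2` by `isMinimalAt_two_of_kraus_fails_int`, at odd `p`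
by Silverman's criterion `ord_p Δ < 12`, *AEC* VII.1 Remark 1.1; VIII.8).
[cite: Kraus1989, Prop. 2] [cite: SilvermanAEC2009, VII.1 Remark 1.1] -/
theorem isGloballyMinimal_baseChange_int_of_kraus (M : WeierstrassCurve ℤ) {d : ℤ}
    (h8 : ¬ (2 : ℤ) ^ 8 ∣ M.c₄) (h6 : M.c₆ = 64 * d) (hd : ¬ (2 : ℤ) ^ 2 ∣ d + 1)
    (hodd : ∀ p : ℕ, p.Prime → p ≠ 2 → ¬ (p : ℤ) ^ 12 ∣ M.Δ) :
    (M.baseChange ℚ).IsGloballyMinimal where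
  isIntegral := by
    refine isIntegral_of_exists_lift (𝓞 ℚ) ⟨(M.a₁ : 𝓞 ℚ), ?_⟩ ⟨(M.a₂ : 𝓞 ℚ), ?_⟩ ⟨(M.a₃ : 𝓞 ℚ), ?_⟩
      ⟨(M.a₄ : 𝓞 ℚ), ?_⟩ ⟨(M.a₆ : 𝓞 ℚ), ?_⟩ <;> simp [baseChange]
  isMinimal v := by
    by_cases hv : natGenerator v = 2
    · exact isMinimalAt_two_of_kraus_fails_int v hv M h8 h6 hd
    · have hint : (M.baseChange ℚ).IsIntegralAt v := by
        have hle : ∀ m : ℤ, v.valuation ℚ (m : ℚ) ≤ 1 := fun m ↦ by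
          have hm : (m : ℚ) = algebraMap (𝓞 ℚ) ℚ (m : 𝓞 ℚ) := by simp
          rw [hm]; exact v.valuation_le_one _
        refine (M.baseChange ℚ).isIntegralAt_of_valuation_le_one v ?_ ?_ ?_ ?_ ?_ <;>
          simp only [baseChange, map_a₁, map_a₂, map_a₃, map_a₄, map_a₆, algebraMap_int_eq,
            Int.coe_castRingHom] <;> exact hle _
      refine isMinimalAt_of_lt_valuation_Δ_holds hint ?_
      rw [baseChange_int_Δ]
      exact exp_neg_lt_valuation_intCast_of_not_pow_dvd v (hodd _ (prime_natGenerator v) hv)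

/-- `p¹² ∤ ±2ᵏ · 7³` for an odd prime `p` (`k = 12, 18`): the odd part of the three discriminants
`Δ(784) = −2¹²·7³`, `Δ(3136∓) = −2¹⁸·7³` is `7³`. [folklore] -/
theorem not_pow_twelve_dvd_of_odd_prime {p : ℕ} (hp : p.Prime) (hp2 : p ≠ 2) (k : ℕ) :
    ¬ (p : ℤ) ^ 12 ∣ -(2 ^ k * 7 ^ 3) := by
  rw [dvd_neg]
  intro h
  have h' : p ^ 12 ∣ 2 ^ k * 7 ^ 3 := by exact_mod_cast h
  have h1 : p ∣ 2 ^ k * 7 ^ 3 := dvd_trans (dvd_pow_self p (by norm_num)) h'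
  rcases (Nat.Prime.dvd_mul hp).mp h1 with h2 | h7
  · exact hp2 ((Nat.prime_dvd_prime_iff_eq hp Nat.prime_two).mp (hp.dvd_of_dvd_pow h2))
  · have hp7 : p = 7 := (Nat.prime_dvd_prime_iff_eq hp (by norm_num)).mp (hp.dvd_of_dvd_pow h7)
    subst hp7
    have h4 : 7 ^ 3 * 7 ∣ 7 ^ 3 * 2 ^ k := by
      rw [← pow_succ, mul_comm (7 ^ 3)]
      exact dvd_trans (pow_dvd_pow 7 (by norm_num)) h'
    rw [Nat.mul_dvd_mul_iff_left (by norm_num)] at h4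
    have : 7 ∣ 2 := (Nat.prime_iff.mp hp).dvd_of_dvd_pow h4
    omega

/-- `[0, −21, 0, 112, 0] = ℤ-model ⊗ ℚ`. [folklore] -/
theorem twoTorsionModel_neg_one_eq_baseChange :
    (⟨0, -21, 0, 112, 0⟩ : WeierstrassCurve ℚ) = (⟨0, -21, 0, 112, 0⟩ : WeierstrassCurve ℤ).baseChange ℚ := by
  ext <;> simp [baseChange]

/-- `[0, −42, 0, 448, 0] = ℤ-model ⊗ ℚ`. [folklore] -/
theorem twoTorsionModel_neg_two_eq_baseChange :
    (⟨0, -42, 0, 448, 0⟩ : WeierstrassCurve ℚ) = (⟨0, -42, 0, 448, 0⟩ : WeierstrassCurve ℤ).baseChange ℚ := by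
  ext <;> simp [baseChange]

/-- `[0, 42, 0, 448, 0] = ℤ-model ⊗ ℚ`. [folklore] -/
theorem twoTorsionModel_two_eq_baseChange :
    (⟨0, 42, 0, 448, 0⟩ : WeierstrassCurve ℚ) = (⟨0, 42, 0, 448, 0⟩ : WeierstrassCurve ℤ).baseChange ℚ := by
  ext <;> simp [baseChange]

/-- Invariants of `[0, −21, 0, 112, 0]`: `c₄ = 1680 = 2⁴·105`, `c₆ = −84672 = 64·(−1323)`,
`Δ = −1404928 = −2¹²·7³`. [cite: CremonaAlgorithms1997, Table 1 (curve 784)] -/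
theorem invariants_twoTorsionModel_neg_one :
    (⟨0, -21, 0, 112, 0⟩ : WeierstrassCurve ℤ).c₄ = 1680 ∧
      (⟨0, -21, 0, 112, 0⟩ : WeierstrassCurve ℤ).c₆ = 64 * (-1323) ∧
        (⟨0, -21, 0, 112, 0⟩ : WeierstrassCurve ℤ).Δ = -(2 ^ 12 * 7 ^ 3) := by
  refine ⟨by decide, by decide, by decide⟩

/-- Invariants of `[0, −42, 0, 448, 0]`: `c₄ = 6720 = 2⁶·105`, `c₆ = −677376 = 64·(−10584)`,
`Δ = −2¹⁸·7³`. [cite: CremonaAlgorithms1997, Table 1 (curve 3136)] -/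
theorem invariants_twoTorsionModel_neg_two :
    (⟨0, -42, 0, 448, 0⟩ : WeierstrassCurve ℤ).c₄ = 6720 ∧
      (⟨0, -42, 0, 448, 0⟩ : WeierstrassCurve ℤ).c₆ = 64 * (-10584) ∧
        (⟨0, -42, 0, 448, 0⟩ : WeierstrassCurve ℤ).Δ = -(2 ^ 18 * 7 ^ 3) := by
  refine ⟨by decide, by decide, by decide⟩

/-- Invariants of `[0, 42, 0, 448, 0]`: `c₄ = 6720`, `c₆ = 677376 = 64·10584`, `Δ = −2¹⁸·7³`.
[cite: CremonaAlgorithms1997, Table 1 (curve 3136)] -/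
theorem invariants_twoTorsionModel_two :
    (⟨0, 42, 0, 448, 0⟩ : WeierstrassCurve ℤ).c₄ = 6720 ∧
      (⟨0, 42, 0, 448, 0⟩ : WeierstrassCurve ℤ).c₆ = 64 * 10584 ∧
        (⟨0, 42, 0, 448, 0⟩ : WeierstrassCurve ℤ).Δ = -(2 ^ 18 * 7 ^ 3) := by
  refine ⟨by decide, by decide, by decide⟩

/-- **`[0, −21, 0, 112, 0]` is a global minimal model of `49a1^{(−1)}`** (`ord₂ Δ = 12`,
`ord₂ c₄ = 4`: Silverman's criterion fails at `2`; Kraus: `2⁸ ∤ c₄`, `c₆/64 = −1323 ≢ 3 (mod 4)`).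
[cite: Kraus1989, Prop. 2] [cite: SilvermanAEC2009, VII.1 Remark 1.1] -/
theorem isGloballyMinimal_twoTorsionModel_neg_one :
    (⟨0, -21, 0, 112, 0⟩ : WeierstrassCurve ℚ).IsGloballyMinimal := by
  obtain ⟨h4, h6, hΔ⟩ := invariants_twoTorsionModel_neg_one
  rw [twoTorsionModel_neg_one_eq_baseChange]
  exact isGloballyMinimal_baseChange_int_of_kraus _ (by rw [h4]; decide) h6 (by decide)
    (fun p hp hp2 ↦ by rw [hΔ]; exact not_pow_twelve_dvd_of_odd_prime hp hp2 12)

/-- **`[0, −42, 0, 448, 0]` is a global minimal model of `49a1^{(−2)}`** (`ord₂ Δ = 18`, `ord₂ c₄ = 6`;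
Kraus: `2⁸ ∤ c₄`, `c₆/64 = −10584 ≢ 3 (mod 4)`). [cite: Kraus1989, Prop. 2] [cite: SilvermanAEC2009, VII.1 Remark 1.1] -/
theorem isGloballyMinimal_twoTorsionModel_neg_two :
    (⟨0, -42, 0, 448, 0⟩ : WeierstrassCurve ℚ).IsGloballyMinimal := by
  obtain ⟨h4, h6, hΔ⟩ := invariants_twoTorsionModel_neg_two
  rw [twoTorsionModel_neg_two_eq_baseChange]
  exact isGloballyMinimal_baseChange_int_of_kraus _ (by rw [h4]; decide) h6 (by decide)
    (fun p hp hp2 ↦ by rw [hΔ]; exact not_pow_twelve_dvd_of_odd_prime hp hp2 18)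

/-- **`[0, 42, 0, 448, 0]` is a global minimal model of `49a1^{(2)}`** (Kraus: `2⁸ ∤ c₄`,
`c₆/64 = 10584 ≢ 3 (mod 4)`). [cite: Kraus1989, Prop. 2] [cite: SilvermanAEC2009, VII.1 Remark 1.1] -/
theorem isGloballyMinimal_twoTorsionModel_two :
    (⟨0, 42, 0, 448, 0⟩ : WeierstrassCurve ℚ).IsGloballyMinimal := by
  obtain ⟨h4, h6, hΔ⟩ := invariants_twoTorsionModel_two
  rw [twoTorsionModel_two_eq_baseChange]
  exact isGloballyMinimal_baseChange_int_of_kraus _ (by rw [h4]; decide) h6 (by decide)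
    (fun p hp hp2 ↦ by rw [hΔ]; exact not_pow_twelve_dvd_of_odd_prime hp hp2 18)

end Global

/-! ## §3 Conductors (from the Modularity Theorem `exists_isNewformOf`, Atkin–Lehner) -/

section Conductor

/-- **`N([0, −21, 0, 112, 0]) = 784`**: `N(cm7^{(−1)}) = 16 · N(X₀(49)) = 16 · 49` (tree
`conductorNorm_quadraticTwist_neg_one`: `X₀(49)` has odd conductor and its `−1`-twist is additive at
`2`), transported along the two-torsion change (`conductorNorm_smul_rat`).
[cite: AtkinLehner1970, §6] [cite: CremonaAlgorithms1997, Table 1 (curve 784)] -/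
theorem conductorNorm_twoTorsionModel_neg_one (hmod : exists_isNewformOf) :
    (⟨0, -21, 0, 112, 0⟩ : WeierstrassCurve ℚ).conductorNorm ℤ = 784 := by
  haveI := isElliptic_cm7_quadraticTwist_neg_one
  rw [← twoTorsionChange_smul_cm7_quadraticTwist_neg_one_rat, conductorNorm_smul_rat]
  have h := cm7.conductorNorm_quadraticTwist_neg_one hmod (by rw [conductorNorm_cm7]; norm_num)
    (fun v hv ↦ by exact_mod_cast hasAdditiveReductionAt_quadraticTwist_cm7_base (Or.inl rfl) v hv)
  rw [h, conductorNorm_cm7]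

/-- **`N([0, −42, 0, 448, 0]) = 3136`**: `N(cm7^{(−2)}) = 64 · N(X₀(49))` (tree
`rootNumber_quadraticTwist_neg_two`, `X₀(49)` good at `2`). [cite: AtkinLehner1970, §6]
[cite: CremonaAlgorithms1997, Table 1 (curve 3136)] -/
theorem conductorNorm_twoTorsionModel_neg_two (hmod : exists_isNewformOf) :
    (⟨0, -42, 0, 448, 0⟩ : WeierstrassCurve ℚ).conductorNorm ℤ = 3136 := by
  haveI := isElliptic_cm7_quadraticTwist_neg_two
  rw [← twoTorsionChange_smul_cm7_quadraticTwist_neg_two_rat, conductorNorm_smul_rat]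
  have h := (cm7.rootNumber_quadraticTwist_neg_two hmod (by rw [conductorNorm_cm7]; norm_num)
    hasGoodReductionAt_cm7_of_natGenerator_eq_two).2
  rw [h, conductorNorm_cm7]

/-- `cm7^{(2)}` is elliptic. [folklore] -/
theorem isElliptic_cm7_quadraticTwist_two : (cm7.quadraticTwist 2).IsElliptic :=
  cm7.isElliptic_quadraticTwist (by norm_num)

/-- The two-torsion change over `ℚ`: `(1/2, 4, 0, 0) • cm7^{(2)} = [0, 42, 0, 448, 0]`.
[cite: SilvermanAEC2009, III.1 Table 3.1] -/
theorem twoTorsionChange_smul_cm7_quadraticTwist_two_rat :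
    (⟨(Units.mk0 (2 : ℚ) two_ne_zero)⁻¹, 4, 0, 0⟩ : VariableChange ℚ) • cm7.quadraticTwist 2 =
      ⟨0, 42, 0, 448, 0⟩ := by
  ext <;> simp [quadraticTwist, b₂, b₄, b₆, variableChange_a₁, variableChange_a₂,
    variableChange_a₃, variableChange_a₄, variableChange_a₆] <;> norm_num

/-- **`N([0, 42, 0, 448, 0]) = 3136`**: `N(cm7^{(2)}) = 64 · N(X₀(49))` (tree
`rootNumber_quadraticTwist_two`). [cite: AtkinLehner1970, §6] [cite: CremonaAlgorithms1997, Table 1 (curve 3136)] -/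
theorem conductorNorm_twoTorsionModel_two (hmod : exists_isNewformOf) :
    (⟨0, 42, 0, 448, 0⟩ : WeierstrassCurve ℚ).conductorNorm ℤ = 3136 := by
  haveI := isElliptic_cm7_quadraticTwist_two
  rw [← twoTorsionChange_smul_cm7_quadraticTwist_two_rat, conductorNorm_smul_rat]
  have h := (cm7.rootNumber_quadraticTwist_two hmod (by rw [conductorNorm_cm7]; norm_num)
    hasGoodReductionAt_cm7_of_natGenerator_eq_two).2
  rw [h, conductorNorm_cm7]

end Conductor

/-! ## §4 The bsd.S31 hook: full BSD for `784` and `3136⁻` BY NAME, hence `r_an = 1` and `#Ш` odd -/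

section S31

/-- A finite additive group without elements killed by `2` (other than `0`) has ODD order (Cauchy).
[folklore] -/
theorem odd_natCard_of_forall_two_nsmul {G : Type*} [AddCommGroup G] [Finite G]
    (h : ∀ c : G, 2 • c = 0 → c = 0) : Odd (Nat.card G) := by
  rw [← Nat.not_even_iff_odd, even_iff_two_dvd]
  intro h2
  haveI : Fact (Nat.Prime 2) := ⟨Nat.prime_two⟩
  obtain ⟨x, hx⟩ := exists_prime_addOrderOf_dvd_card' 2 h2
  have hx0 : x = 0 := h x (by rw [← hx]; exact addOrderOf_nsmul_eq_zero x)
  rw [hx0, addOrderOf_zero] at hx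
  exact absurd hx (by norm_num)

/-- `[0, −21, 0, 112, 0]` is elliptic (it is `(1/2,−2,0,0) • cm7^{(−1)}`). [folklore] -/
theorem isElliptic_twoTorsionModel_neg_one : (⟨0, -21, 0, 112, 0⟩ : WeierstrassCurve ℚ).IsElliptic := by
  haveI := isElliptic_cm7_quadraticTwist_neg_one
  rw [← twoTorsionChange_smul_cm7_quadraticTwist_neg_one_rat]; infer_instance

/-- `[0, −42, 0, 448, 0]` is elliptic. [folklore] -/
theorem isElliptic_twoTorsionModel_neg_two : (⟨0, -42, 0, 448, 0⟩ : WeierstrassCurve ℚ).IsElliptic := by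
  haveI := isElliptic_cm7_quadraticTwist_neg_two
  rw [← twoTorsionChange_smul_cm7_quadraticTwist_neg_two_rat]; infer_instance

/-- `rank [0, −21, 0, 112, 0](ℚ) = 1` and `Ш[2] = 0` (transport of file I along the two-torsion change).
[cite: SilvermanAEC2009, Thm. X.4.2(a) and III.3.1(b)] -/
theorem rank_and_sha_two_twoTorsionModel_neg_one :
    (⟨0, -21, 0, 112, 0⟩ : WeierstrassCurve ℚ).mordellWeilRank = 1 ∧
      ∀ c ∈ (⟨0, -21, 0, 112, 0⟩ : WeierstrassCurve ℚ).sha, 2 • c = 0 → c = 0 := by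
  haveI := isElliptic_cm7_quadraticTwist_neg_one
  haveI := isElliptic_twoTorsionModel_neg_one
  set C : VariableChange ℚ := ⟨(Units.mk0 (2 : ℚ) two_ne_zero)⁻¹, -2, 0, 0⟩ with hC
  have hE : C⁻¹ • (⟨0, -21, 0, 112, 0⟩ : WeierstrassCurve ℚ) = cm7.quadraticTwist (-1) := by
    rw [← twoTorsionChange_smul_cm7_quadraticTwist_neg_one_rat, inv_smul_smul]
  have hrk : (⟨0, -21, 0, 112, 0⟩ : WeierstrassCurve ℚ).mordellWeilRank = 1 := by
    rw [← twoTorsionChange_smul_cm7_quadraticTwist_neg_one_rat, ← mordellWeilRank_cm7_quadraticTwist_neg_one]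
    have h := mordellWeilRank_variableChange_holds (cm7.quadraticTwist (-1)) C
    unfold mordellWeilRank_variableChange at h
    convert h using 2
  refine ⟨hrk, (rank_le_one_and_sha_two_of_smul_eq _ _ C⁻¹ hE
    ⟨rank_le_one_and_sha_two_cm7_quadraticTwist_neg_one.1, fun _ ↦
      forall_mem_sha_two_cm7_quadraticTwist_neg_one⟩).2 hrk⟩

/-- `rank [0, −42, 0, 448, 0](ℚ) = 1` and `Ш[2] = 0`. [cite: SilvermanAEC2009, Thm. X.4.2(a) and III.3.1(b)] -/
theorem rank_and_sha_two_twoTorsionModel_neg_two :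
    (⟨0, -42, 0, 448, 0⟩ : WeierstrassCurve ℚ).mordellWeilRank = 1 ∧
      ∀ c ∈ (⟨0, -42, 0, 448, 0⟩ : WeierstrassCurve ℚ).sha, 2 • c = 0 → c = 0 := by
  haveI := isElliptic_cm7_quadraticTwist_neg_two
  haveI := isElliptic_twoTorsionModel_neg_two
  set C : VariableChange ℚ := ⟨(Units.mk0 (2 : ℚ) two_ne_zero)⁻¹, -4, 0, 0⟩ with hC
  have hE : C⁻¹ • (⟨0, -42, 0, 448, 0⟩ : WeierstrassCurve ℚ) = cm7.quadraticTwist (-2) := by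
    rw [← twoTorsionChange_smul_cm7_quadraticTwist_neg_two_rat, inv_smul_smul]
  have hrk : (⟨0, -42, 0, 448, 0⟩ : WeierstrassCurve ℚ).mordellWeilRank = 1 := by
    rw [← twoTorsionChange_smul_cm7_quadraticTwist_neg_two_rat, ← mordellWeilRank_cm7_quadraticTwist_neg_two]
    have h := mordellWeilRank_variableChange_holds (cm7.quadraticTwist (-2)) C
    unfold mordellWeilRank_variableChange at h
    convert h using 2
  refine ⟨hrk, (rank_le_one_and_sha_two_of_smul_eq _ _ C⁻¹ hE
    ⟨rank_le_one_and_sha_two_cm7_quadraticTwist_neg_two.1, fun _ ↦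
      forall_mem_sha_two_cm7_quadraticTwist_neg_two⟩).2 hrk⟩

/-- **Full BSD for the `784`-curve BY NAME (bsd.S31, Creutz–Miller / Miller 2011: `rank ≤ 1`,
`N < 5000`)**: granted `bsdTriple_of_rank_le_one_of_conductor_lt` and Modularity (for `N = 784`), the
globally minimal model `[0, −21, 0, 112, 0]` of `49a1^{(−1)}` satisfies RANK ∧ SHAFIN ∧ LEAD. Inputs:
`rank = 1` (file I, kernel), `IsGloballyMinimal` (§2, kernel), `N = 784` (§3).
[cite: CreutzMiller2012, Thm 1.1 and the remark following it] [cite: Miller2011LMS, Thm 1.2] -/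
theorem bsdTriple_twoTorsionModel_neg_one (hS31 : bsdTriple_of_rank_le_one_of_conductor_lt)
    (hmod : exists_isNewformOf) : (⟨0, -21, 0, 112, 0⟩ : WeierstrassCurve ℚ).BSDTriple := by
  haveI := isElliptic_twoTorsionModel_neg_one
  haveI := isGloballyMinimal_twoTorsionModel_neg_one
  exact hS31 _ (le_of_eq rank_and_sha_two_twoTorsionModel_neg_one.1)
    (by rw [conductorNorm_twoTorsionModel_neg_one hmod]; norm_num)

/-- **Full BSD for the `3136⁻`-curve BY NAME** (`[0, −42, 0, 448, 0]`, `rank = 1`, `N = 3136 < 5000`).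
[cite: CreutzMiller2012, Thm 1.1 and the remark following it] [cite: Miller2011LMS, Thm 1.2] -/
theorem bsdTriple_twoTorsionModel_neg_two (hS31 : bsdTriple_of_rank_le_one_of_conductor_lt)
    (hmod : exists_isNewformOf) : (⟨0, -42, 0, 448, 0⟩ : WeierstrassCurve ℚ).BSDTriple := by
  haveI := isElliptic_twoTorsionModel_neg_two
  haveI := isGloballyMinimal_twoTorsionModel_neg_two
  exact hS31 _ (le_of_eq rank_and_sha_two_twoTorsionModel_neg_two.1)
    (by rw [conductorNorm_twoTorsionModel_neg_two hmod]; norm_num)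

/-- **Consequences for `784`**: `r_an = 1`, `Ш` finite of ODD order (`Ш[2] = 0` in the kernel +
finiteness from S31 + Cauchy), and the leading-term formula — the exact fixed-curve inputs of Theorem A
of the genus mechanism (memo B49-GENUS §3: «only its `2`-part and `Ш_an = #Ш` are used»).
[cite: CreutzMiller2012, Thm 1.1 and the remark following it] -/
theorem analyticRank_shaFinite_odd_twoTorsionModel_neg_one
    (hS31 : bsdTriple_of_rank_le_one_of_conductor_lt) (hmod : exists_isNewformOf) :
    (⟨0, -21, 0, 112, 0⟩ : WeierstrassCurve ℚ).analyticRank = 1 ∧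
      (⟨0, -21, 0, 112, 0⟩ : WeierstrassCurve ℚ).ShaFinite ∧
      Odd (⟨0, -21, 0, 112, 0⟩ : WeierstrassCurve ℚ).shaOrder ∧
      (⟨0, -21, 0, 112, 0⟩ : WeierstrassCurve ℚ).BSDLeadingTermFormula := by
  obtain ⟨hrank, hfin, hlead⟩ := bsdTriple_twoTorsionModel_neg_one hS31 hmod
  obtain ⟨hr1, hsha⟩ := rank_and_sha_two_twoTorsionModel_neg_one
  refine ⟨hrank.trans hr1, hfin, ?_, hlead⟩
  haveI : Finite (⟨0, -21, 0, 112, 0⟩ : WeierstrassCurve ℚ).sha := hfin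
  exact odd_natCard_of_forall_two_nsmul fun c hc ↦
    Subtype.ext (hsha c c.2 (by exact_mod_cast congrArg Subtype.val hc))

/-- **Consequences for `3136⁻`**: `r_an = 1`, `Ш` finite of ODD order, leading-term formula.
[cite: CreutzMiller2012, Thm 1.1 and the remark following it] -/
theorem analyticRank_shaFinite_odd_twoTorsionModel_neg_two
    (hS31 : bsdTriple_of_rank_le_one_of_conductor_lt) (hmod : exists_isNewformOf) :
    (⟨0, -42, 0, 448, 0⟩ : WeierstrassCurve ℚ).analyticRank = 1 ∧
      (⟨0, -42, 0, 448, 0⟩ : WeierstrassCurve ℚ).ShaFinite ∧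
      Odd (⟨0, -42, 0, 448, 0⟩ : WeierstrassCurve ℚ).shaOrder ∧
      (⟨0, -42, 0, 448, 0⟩ : WeierstrassCurve ℚ).BSDLeadingTermFormula := by
  obtain ⟨hrank, hfin, hlead⟩ := bsdTriple_twoTorsionModel_neg_two hS31 hmod
  obtain ⟨hr1, hsha⟩ := rank_and_sha_two_twoTorsionModel_neg_two
  refine ⟨hrank.trans hr1, hfin, ?_, hlead⟩
  haveI : Finite (⟨0, -42, 0, 448, 0⟩ : WeierstrassCurve ℚ).sha := hfin
  exact odd_natCard_of_forall_two_nsmul fun c hc ↦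
    Subtype.ext (hsha c c.2 (by exact_mod_cast congrArg Subtype.val hc))

end S31
end Summit.BirchSwinnertonDyer.BirchSwinnertonDyer.Theorems.GoldfeldGoodTwists

end
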